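import Mathlib.Logic.Equiv.Fin.Basic
import Mathlib.Data.Fintype.Basic
import Mathlib.Tactic

set_option linter.dupNamespace false
set_option autoImplicit false

/-!
# Universal occurrence — two rectangles and the type `(2N-7,5,1,1)`, part B: lift arithmetic (decomp-mm · lens 3 · gen 44)

Route `route-MatrixMultiplication-ObstructionDescent` (sub-problem `MatrixMultiplication`, `ω(ℂ) = 2`); SUPPORT for the crux
`NoOccurrenceObstruction` (`P_O`, item `stmt-MatrixMultiplication-29040`).  Pure arithmetic (no representation theory, no `def`,
no `sorry`): the finite bookkeeping behind the lifted design `D'₂(N)` of part D (`…TwoRectangleOddFiveValue`), isolated so that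
the `omega` transfers and the one enumeration (`decide`) do not load the main files.  Companion of `…TwoRectangleOddThreeArith`,
whose LOCAL SIGN RULE on the model alphabet `[6]` (`oddThree_model_SS/SC/CS/CC`) is reused verbatim for this family.

**The design** (NODE-g44 §2, §4).  Alphabet `[N+2]` = generic letters `n < N` and two LIFTED letters `N, N+1`; first leg
`φ(n) = n (n < N), φ(N) = 0, φ(N+1) = 1`; second leg CROSSED, `ψ(N) = 1, ψ(N+1) = 0`; third leg (row letter of the tableau of
shape `(2N-7,5,1,1)`: column `0..3`, four dominoes `{4,5}, …, {10,11}`, arm) `γ(1) = γ(2) = γ(3) = 1, γ(N) = 2, γ(N+1) = 3`,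
`γ = 0` otherwise.  The four column letters `n_i = ι(p_i)` of a term are classified by the MODEL LETTER `m(n) ∈ [6]`
(`m(n) = n` for `n < 2`, `2` for the ONE-GENERIC letters `2, 3`, `3` for the ZERO-GENERIC letters `4 ≤ n < N`, `n+4-N ∈ {4,5}`
for the lifted letters) — the same model alphabet as for `(2N-5,3,1,1)`, so that family's sign rule applies; the dominoes enter
through `d = γ(ι p_4) + γ(ι p_6) + γ(ι p_8) + γ(ι p_{10}) ∈ {1,2,3}`, tied to the column letters of block `0` by
`d + [n_0 ∈ {2,3}] + [n_2 ∈ {2,3}] + [{n_0,n_2} ∩ {1,N+1} ≠ ∅] = 3` (part C).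

**Contents.**  §1 transfer to the model alphabet (`oddFiveLetter_*`, `omega`).  §2 the slot count behind the domino sum
(`oddFive_slot_count`, `decide` over `[6]^3`).

[cite: BurgisserIkenmeyer2011, Thm. 4.4, Lemma 6.1] [cite: BurgisserIkenmeyer2017, §5, Thm. 5.9 (proof of (2)), eq. (3.4)]
-/

namespace Summit.MatrixMultiplication.MatrixMultiplication.Theorems.ObstructionCalculus

/-! ### §1 Transfer to the model alphabet `[6]` -/

/-- The model letter is `< 6`. [this node] -/
theorem oddFiveLetter_lt {N n k : ℕ} (hn : n < N + 2) (hk : k = (if n < 2 then n else if n < 4 then 2 else if n < N then 3 else n + 4 - N)) : k < 6 := by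
  subst hk
  split_ifs <;> omega

/-- The row letter `γ(n)` is read off the model letter. [this node] -/
theorem oddFiveLetter_col {N n k : ℕ} (hN : 6 ≤ N) (hn : n < N + 2) (hk : k = (if n < 2 then n else if n < 4 then 2 else if n < N then 3 else n + 4 - N)) :
    (if n = 1 then 1 else if n = 2 then 1 else if n = 3 then 1 else if n = N then 2 else if n = N + 1 then 3 else 0) =
      (if k = 1 then 1 else if k = 2 then 1 else if k = 4 then 2 else if k = 5 then 3 else 0) := by
  have hk2 : (n < 2 ∧ k = n) ∨ (2 ≤ n ∧ n < 4 ∧ k = 2) ∨ (4 ≤ n ∧ n < N ∧ k = 3) ∨ (N ≤ n ∧ k = n + 4 - N) := by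
    rw [hk]; split_ifs <;> omega
  clear hk
  split_ifs <;> omega

/-- A one-generic letter `2 ≤ n < 4` has row letter `1`. [this node] -/
theorem oddFiveLetter_col_oneGeneric {N n : ℕ} (hN : 6 ≤ N) (h2 : 2 ≤ n) (hn : n < 4) :
    (if n = 1 then 1 else if n = 2 then 1 else if n = 3 then 1 else if n = N then 2 else if n = N + 1 then 3 else 0) = 1 := by
  split_ifs <;> omega

/-- A zero-generic letter `4 ≤ n < N` has row letter `0`. [this node] -/
theorem oddFiveLetter_col_zeroGeneric {N n : ℕ} (h4 : 4 ≤ n) (hn : n < N) :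
    (if n = 1 then 1 else if n = 2 then 1 else if n = 3 then 1 else if n = N then 2 else if n = N + 1 then 3 else 0) = 0 := by
  split_ifs <;> omega

/-- `φ(n) = ψ(n')` transfers to the model letters. [this node] -/
theorem oddFiveLetter_eq {N n n' k k' : ℕ} (hN : 6 ≤ N) (hn : n < N + 2) (hn' : n' < N + 2) (hk : k = (if n < 2 then n else if n < 4 then 2 else if n < N then 3 else n + 4 - N))
    (hk' : k' = (if n' < 2 then n' else if n' < 4 then 2 else if n' < N then 3 else n' + 4 - N)) (h : (if n < N then n else n - N) = (if n' < N then n' else N + 1 - n')) :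
    (if k < 4 then k else k - 4) = (if k' < 4 then k' else 5 - k') := by
  have hk2 : (n < 2 ∧ k = n) ∨ (2 ≤ n ∧ n < 4 ∧ k = 2) ∨ (4 ≤ n ∧ n < N ∧ k = 3) ∨ (N ≤ n ∧ k = n + 4 - N) := by
    rw [hk]; split_ifs <;> omega
  have hk2' : (n' < 2 ∧ k' = n') ∨ (2 ≤ n' ∧ n' < 4 ∧ k' = 2) ∨ (4 ≤ n' ∧ n' < N ∧ k' = 3) ∨ (N ≤ n' ∧ k' = n' + 4 - N) := by
    rw [hk']; split_ifs <;> omega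
  have hh : (n < N ∧ n' < N ∧ n = n') ∨ (n < N ∧ N ≤ n' ∧ n = N + 1 - n') ∨ (N ≤ n ∧ n' < N ∧ n - N = n') ∨
      (N ≤ n ∧ N ≤ n' ∧ n - N = N + 1 - n') := by
    split_ifs at h <;> omega
  clear hk hk' h
  split_ifs <;> omega

/-- `φ(n) ≠ φ(n')` transfers to the model letters unless both letters are generic of the same kind. [this node] -/
theorem oddFiveLetter_ne_fst {N n n' k k' : ℕ} (hN : 6 ≤ N) (hn : n < N + 2) (hn' : n' < N + 2) (hk : k = (if n < 2 then n else if n < 4 then 2 else if n < N then 3 else n + 4 - N))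
    (hk' : k' = (if n' < 2 then n' else if n' < 4 then 2 else if n' < N then 3 else n' + 4 - N)) (hgen₁ : ¬ (2 ≤ n ∧ n < 4 ∧ 2 ≤ n' ∧ n' < 4)) (hgen₀ : ¬ (4 ≤ n ∧ n < N ∧ 4 ≤ n' ∧ n' < N))
    (h : (if n < N then n else n - N) ≠ (if n' < N then n' else n' - N)) :
    (if k < 4 then k else k - 4) ≠ (if k' < 4 then k' else k' - 4) := by
  have hk2 : (n < 2 ∧ k = n) ∨ (2 ≤ n ∧ n < 4 ∧ k = 2) ∨ (4 ≤ n ∧ n < N ∧ k = 3) ∨ (N ≤ n ∧ k = n + 4 - N) := by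
    rw [hk]; split_ifs <;> omega
  have hk2' : (n' < 2 ∧ k' = n') ∨ (2 ≤ n' ∧ n' < 4 ∧ k' = 2) ∨ (4 ≤ n' ∧ n' < N ∧ k' = 3) ∨ (N ≤ n' ∧ k' = n' + 4 - N) := by
    rw [hk']; split_ifs <;> omega
  have hh : (n < N ∧ n' < N ∧ n ≠ n') ∨ (n < N ∧ N ≤ n' ∧ n ≠ n' - N) ∨ (N ≤ n ∧ n' < N ∧ n - N ≠ n') ∨
      (N ≤ n ∧ N ≤ n' ∧ n ≠ n') := by
    split_ifs at h <;> omega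
  clear hk hk' h
  split_ifs <;> omega

/-- `ψ(n) ≠ ψ(n')` transfers to the model letters unless both letters are generic of the same kind. [this node] -/
theorem oddFiveLetter_ne_snd {N n n' k k' : ℕ} (hN : 6 ≤ N) (hn : n < N + 2) (hn' : n' < N + 2) (hk : k = (if n < 2 then n else if n < 4 then 2 else if n < N then 3 else n + 4 - N))
    (hk' : k' = (if n' < 2 then n' else if n' < 4 then 2 else if n' < N then 3 else n' + 4 - N)) (hgen₁ : ¬ (2 ≤ n ∧ n < 4 ∧ 2 ≤ n' ∧ n' < 4)) (hgen₀ : ¬ (4 ≤ n ∧ n < N ∧ 4 ≤ n' ∧ n' < N))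
    (h : (if n < N then n else N + 1 - n) ≠ (if n' < N then n' else N + 1 - n')) :
    (if k < 4 then k else 5 - k) ≠ (if k' < 4 then k' else 5 - k') := by
  have hk2 : (n < 2 ∧ k = n) ∨ (2 ≤ n ∧ n < 4 ∧ k = 2) ∨ (4 ≤ n ∧ n < N ∧ k = 3) ∨ (N ≤ n ∧ k = n + 4 - N) := by
    rw [hk]; split_ifs <;> omega
  have hk2' : (n' < 2 ∧ k' = n') ∨ (2 ≤ n' ∧ n' < 4 ∧ k' = 2) ∨ (4 ≤ n' ∧ n' < N ∧ k' = 3) ∨ (N ≤ n' ∧ k' = n' + 4 - N) := by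
    rw [hk']; split_ifs <;> omega
  have hh : (n < N ∧ n' < N ∧ n ≠ n') ∨ (n < N ∧ N ≤ n' ∧ n ≠ N + 1 - n') ∨ (N ≤ n ∧ n' < N ∧ N + 1 - n ≠ n') ∨
      (N ≤ n ∧ N ≤ n' ∧ n ≠ n') := by
    split_ifs at h <;> omega
  clear hk hk' h
  split_ifs <;> omega

/-- The domino correction `[n ∈ {2,3}] + [n' ∈ {2,3}] + [{n,n'} ∩ {1,N+1} ≠ ∅]` is read off the model letters when the
two letters have different row letters. [this node] -/
theorem oddFiveLetter_dd {N n n' k k' : ℕ} (hN : 6 ≤ N) (hn : n < N + 2) (hn' : n' < N + 2) (hk : k = (if n < 2 then n else if n < 4 then 2 else if n < N then 3 else n + 4 - N))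
    (hk' : k' = (if n' < 2 then n' else if n' < 4 then 2 else if n' < N then 3 else n' + 4 - N))
    (hne : (if k = 1 then 1 else if k = 2 then 1 else if k = 4 then 2 else if k = 5 then 3 else 0) ≠
      (if k' = 1 then 1 else if k' = 2 then 1 else if k' = 4 then 2 else if k' = 5 then 3 else 0)) :
    ((if n = 2 ∨ n = 3 then 1 else 0) + (if n' = 2 ∨ n' = 3 then 1 else 0) + (if n = 1 ∨ n' = 1 ∨ n = N + 1 ∨ n' = N + 1 then 1 else 0)) =
      ((if k = 2 ∨ k' = 2 then 1 else 0) + (if k = 1 ∨ k' = 1 ∨ k = 5 ∨ k' = 5 then 1 else 0)) := by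
  have hk2 : (n < 2 ∧ k = n) ∨ (2 ≤ n ∧ n < 4 ∧ k = 2) ∨ (4 ≤ n ∧ n < N ∧ k = 3) ∨ (N ≤ n ∧ k = n + 4 - N) := by
    rw [hk]; split_ifs <;> omega
  have hk2' : (n' < 2 ∧ k' = n') ∨ (2 ≤ n' ∧ n' < 4 ∧ k' = 2) ∨ (4 ≤ n' ∧ n' < N ∧ k' = 3) ∨ (N ≤ n' ∧ k' = n' + 4 - N) := by
    rw [hk']; split_ifs <;> omega
  have hkk : ¬ (k = 2 ∧ k' = 2) := fun hh => by
    obtain ⟨h1, h2⟩ := hh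
    rw [h1, h2] at hne
    exact hne rfl
  clear hk hk' hne
  split_ifs <;> omega

/-! ### §2 The slot count behind the domino sum (`decide` over `[6]^3`) -/

set_option maxHeartbeats 400000 in
set_option synthInstance.maxHeartbeats 400000 in
set_option synthInstance.maxSize 4096 in
/-- **Slot count.**  Three distinct slots `j₁, j₂, j₃ < 6` of block `0` (the cells of the first-leg letters `1, 2, 3`): each
is either one of the two column slots `0, 1` or one of the four domino slots `2, …, 5`, so the indicators add up to `3`.
[this node] -/
theorem oddFive_slot_count (j₁ j₂ j₃ : ℕ) (h₁ : j₁ < 6) (h₂ : j₂ < 6) (h₃ : j₃ < 6) (h₁₂ : j₁ ≠ j₂) (h₁₃ : j₁ ≠ j₃)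
    (h₂₃ : j₂ ≠ j₃) :
    ((if j₁ = 2 then 1 else 0) + (if j₂ = 2 then 1 else 0) + (if j₃ = 2 then 1 else 0)) + ((if j₁ = 3 then 1 else 0) + (if j₂ = 3 then 1 else 0) + (if j₃ = 3 then 1 else 0)) + ((if j₁ = 4 then 1 else 0) + (if j₂ = 4 then 1 else 0) + (if j₃ = 4 then 1 else 0)) + ((if j₁ = 5 then 1 else 0) + (if j₂ = 5 then 1 else 0) + (if j₃ = 5 then 1 else 0)) +
      (if j₂ = 0 ∨ j₃ = 0 then 1 else 0) + (if j₂ = 1 ∨ j₃ = 1 then 1 else 0) + (if j₁ = 0 ∨ j₁ = 1 then 1 else 0) = 3 := by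
  have key : ∀ a b c : Fin 6, (a : ℕ) ≠ (b : ℕ) → (a : ℕ) ≠ (c : ℕ) → (b : ℕ) ≠ (c : ℕ) →
      ((if (a : ℕ) = 2 then 1 else 0) + (if (b : ℕ) = 2 then 1 else 0) + (if (c : ℕ) = 2 then 1 else 0)) + ((if (a : ℕ) = 3 then 1 else 0) + (if (b : ℕ) = 3 then 1 else 0) + (if (c : ℕ) = 3 then 1 else 0)) + ((if (a : ℕ) = 4 then 1 else 0) + (if (b : ℕ) = 4 then 1 else 0) + (if (c : ℕ) = 4 then 1 else 0)) + ((if (a : ℕ) = 5 then 1 else 0) + (if (b : ℕ) = 5 then 1 else 0) + (if (c : ℕ) = 5 then 1 else 0)) +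
      (if (b : ℕ) = 0 ∨ (c : ℕ) = 0 then 1 else 0) + (if (b : ℕ) = 1 ∨ (c : ℕ) = 1 then 1 else 0) + (if (a : ℕ) = 0 ∨ (a : ℕ) = 1 then 1 else 0) = 3 := by
    decide
  exact key ⟨j₁, h₁⟩ ⟨j₂, h₂⟩ ⟨j₃, h₃⟩ h₁₂ h₁₃ h₂₃

end Summit.MatrixMultiplication.MatrixMultiplication.Theorems.ObstructionCalculus
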